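import Literature.AlgebraicGeometry.ModuliOfAbelianVarieties.SiegelFamilyHumbertModularEmbedding
import HarnessLib

/-!
# All Runge models of discriminant `Δ` are `Sp₄(ℤ)`-equivalent, and the Galois involution of `ℍ × ℍ` is
# induced by `Sp₄(ℤ)`: the Humbert surface `H_Δ ⊂ 𝒜₂ = Sp₄(ℤ)\𝔥₂` attached to Runge's standard model

Layer `Literature/AlgebraicGeometry/ModuliOfAbelianVarieties`, namespace
`Literature.AlgebraicGeometry.ModuliOfAbelianVarieties.SiegelModuli`; lane `lit-hodgefound` (Track 2 foundations
library, Layer A4), seat `lit-hodgefound-skel-4`, row **A4-64**, FILE 4. Sequel of FILE 1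
(`SiegelFamilyHumbertModularEmbedding`: `π = modularEmbedding k l hΔ : (Fin 2 → ℍ) → 𝔥₂`, `range_modularEmbedding :
π(ℍ × ℍ) = H_{(k,l,−1,0,0)}`, and the matrix identities `modularEmbeddingMatrix_swap : π(τ₂, τ₁) = ᵗV π(τ) V`,
`V = (1 l; 0 −1)`, `modularEmbeddingMatrix_shift : π_{(k−lu−u², l+2u)}(τ) = ᵗU π_{(k,l)}(τ) U`, `U = (1 u; 0 1)`), read
through the tree's action of `Sp₄(ℝ) ⊇ toGD 1 (Sp₄(ℤ))` on `𝔥₂` (rows A4-16 / A4-56′: `toGD`, `toGD_mem`,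
`SiegelUpperHalfSpace.coe_smul`, `moeb`; row A4-59″ `smul_mem_humbertLocusOfInvariant` uses the same elements
`⟨toGD 1 M, toGD_mem principalType_pos hM⟩`) — consumed BY NAME.

## Sources followed, verbatim

* B. Runge, *Endomorphism rings of abelian surfaces and projective models of their moduli spaces*, Tohoku Math. J.
  **51** (1999), §4 p. 290: "We fix a `ℤ`-basis `1 = ω₁, ω = ω₂` for `O` […] We fix the embedding
  `ℍ × ℍ ∋ (τ₁, τ₂) ↦ π[R] = ᵗR (τ₁ 0; 0 τ₂) R ∈ ℍ₂`", p. 291: "By taking the quotient `Γ(F)\H(F)`, we get the standard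
  model for Humbert surfaces" — the model depends on the basis `R` only up to `Γ₂ = Sp₄(ℤ)`: another generator
  `ω + u` of the same order changes `R` by the unimodular `U = (1 u; 0 1)` and `π` by `Z ↦ ᵗU Z U`, the action of
  `diag(ᵗU, U⁻¹) ∈ Sp₄(ℤ)`.
* N. D. Elkies, A. Kumar, *K3 surfaces and equations for Hilbert modular surfaces*, ANT **8** (2014), §3: "It is
  clear that `A⁺_z ≅ A⁺_{z′}` as principally polarized abelian surfaces with real multiplication if `z`, `z′` are in
  the same orbit [of `SL₂(O_D ⊕ O_D^*) ⋊ C₂`, the `C₂` being `σ : (z₁, z₂) ↦ (z₂, z₁)`] […] we can therefore «forget»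
  this action to get a point in 𝒜₂ […] the map from the Hilbert modular surface […] to the Humbert surface is
  generically 2 to 1" — here: `π(τ^σ) = P_σ · π(τ)` with `P_σ = diag(ᵗV, V) ∈ Sp₄(ℤ)`, `V = (1 l; 0 −1)`.
* H. Lange, *Abelian Varieties over the Complex Numbers* (2023), §3.1.3 Prop. 3.1.6 ("`Sp_{2g}(ℝ)` acts on `𝔥_g` by
  `Z ↦ (αZ + β)(γZ + δ)⁻¹`") and §8.2 (8.5) (the action of `Sp₄(ℤ)`, `𝒜₂ = 𝔥₂/Sp₄(ℤ)`); Ch. Birkenhake–H. Wilhelm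
  2003, Prop. 4.5 (normal forms up to `Sp₄(ℤ)`).

## Contents (definitions with bodies and proved theorems; NO named fact, net debt 0)

* §1 `blockDiag V W = diag(V, ᵗW) ∈ M₄(ℤ)`; `transpose_blockDiag_mul_typeForm_mul` (`ᵗM E₁ M = E₁` for `WV = 1`);
  **`blockDiagSp V W hWV : Sp₄(ℝ)`** `= ⟨toGD 1 (blockDiag V W), _⟩`; `toGD_one_eq_transpose` (`toGD 1 M = ᵗM`);
  `coe_blockDiagSp` (`= diag(ᵗV, W)`); **`coe_blockDiagSp_smul : (P · Z) = ᵗV Z V`**.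
* §2 `swapSp l = diag(ᵗV, V)`, `V = (1 l; 0 −1)`; `shiftSp u = diag(ᵗU, U⁻¹)`, `U = (1 u; 0 1)`;
  **`modularEmbedding_swap_eq_smul : π(τ ∘ swap) = swapSp l · π(τ)`** (the Galois involution is induced by `Sp₄(ℤ)`);
  `swapSp_smul_modularEmbedding_eq_self_iff` (fixed points = the diagonal `τ₁ = τ₂`: "generically 2 to 1");
  **`modularEmbedding_shift_eq_smul : π_{(k−lu−u², l+2u)}(τ) = shiftSp u · π_{(k,l)}(τ)`**;
  `humbertLocus_humbertNormalForm_shift` (`H_{q′} = P_u · H_q`), `smul_humbertLocus_humbertNormalForm_swap`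
  (`P_σ · H_q = H_q`), `exists_shift_of_quadDisc_eq` (same `Δ` ⟹ `l′ = l + 2u`, `k′ = k − lu − u²`), and
  **`exists_humbertLocus_eq_smul_of_quadDisc_eq`**: ANY TWO RUNGE MODELS OF THE SAME DISCRIMINANT ARE
  `Sp₄(ℤ)`-TRANSLATES — `H_Δ := Sp₄(ℤ)·H_{(k,l,−1,0,0)}` depends only on `Δ`.

## Scope

Only the elements `diag(ᵗV, V⁻¹)` are used; Humbert's lemma (that `Sp₄(ℤ)·H_{(k,l,−1,0,0)}` is ALL of `H_Δ(𝔥₂)`,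
B–W Prop. 4.5 / Runge Thm. 2) and the quotient spaces `𝒜₂`, `Γ(F)\H(F)` themselves are not formalised.

## References

* [Runge1999EndomorphismRingsAbelianSurfaces] B. Runge, Tohoku Math. J. 51 (1999) 283–303, §4 (pp. 290–291).
* [ElkiesKumar2014HilbertModularSurfaces] N. D. Elkies, A. Kumar, Algebra & Number Theory 8 (2014) 2297–2411, §3.
* [Lange2023AbelianVarietiesComplex] H. Lange, *Abelian Varieties over the Complex Numbers*, Springer (2023), §3.1.2
  (3.2)–(3.4), §3.1.3 Prop. 3.1.6, §8.2 (8.5).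
* [BirkenhakeWilhelm2003] Ch. Birkenhake, H. Wilhelm, Trans. AMS 355 (2003) 1819–1841, §4 Prop. 4.5 (p. 1828).
-/

noncomputable section

open Matrix Complex Module Function Set
open scoped UpperHalfPlane

namespace Literature.AlgebraicGeometry.ModuliOfAbelianVarieties

namespace SiegelModuli

open Literature.NumberTheory.Automorphic (siegelUpperHalfSpace)
open Literature.NumberTheory.ModularForms.SiegelUpperHalfSpace
open Literature.Geometry.Kaehler Literature.Geometry.Kaehler.ComplexTorus
open Literature.Analysis.Complex Literature.LinearAlgebra.Alternating
open Sum

/-! ## §1 The elements `diag(ᵗV, V⁻¹)` of `Sp₄(ℤ)` and their action `Z ↦ ᵗV Z V` on `𝔥₂` -/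

section BlockDiag

/-- **The integral matrix `diag(V, ᵗW)` for `V ∈ GL₂(ℤ)` with inverse `W`** — the rational representation (tree
convention, row A4-16: `M` acts on `𝔥₂` through `toGD 1 M = ᵗM ∈ Sp₄(ℝ)`) of the change of lattice basis whose action
on `𝔥₂` is the unimodular congruence `Z ↦ ᵗV Z V` ("`M = (α β; γ δ)` acts by `Z ↦ (αZ + β)(γZ + δ)⁻¹`"; here
`α = ᵗV`, `β = γ = 0`, `δ = W = V⁻¹`). [cite: Lange2023AbelianVarietiesComplex, §8.2 (8.5) and §3.1.3 Prop. 3.1.6] -/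
def blockDiag (V W : Matrix (Fin 2) (Fin 2) ℤ) : Matrix (Fin 2 ⊕ Fin 2) (Fin 2 ⊕ Fin 2) ℤ :=
  Matrix.fromBlocks V 0 0 Wᵀ

/-- `E₁ = (0 1; −1 0)` in blocks. [cite: Lange2023AbelianVarietiesComplex, §3.1.4 (3.4)] -/
private theorem typeForm_one_eq_fromBlocks :
    typeForm (fun _ : Fin 2 ↦ 1) = Matrix.fromBlocks 0 1 (-1) 0 := by
  rw [typeForm_one_eq_neg_J, Matrix.J, Matrix.fromBlocks_neg, neg_zero, neg_neg]

/-- **`diag(V, ᵗW)` is symplectic: `ᵗM E₁ M = E₁`** when `WV = 1`. [cite: Lange2023AbelianVarietiesComplex, §3.1.4 (3.4)] -/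
theorem transpose_blockDiag_mul_typeForm_mul {V W : Matrix (Fin 2) (Fin 2) ℤ} (hWV : W * V = 1) :
    (blockDiag V W)ᵀ * typeForm (fun _ : Fin 2 ↦ 1) * blockDiag V W = typeForm (fun _ : Fin 2 ↦ 1) := by
  have hT : Vᵀ * Wᵀ = 1 := by rw [← Matrix.transpose_mul, hWV, Matrix.transpose_one]
  rw [typeForm_one_eq_fromBlocks, blockDiag, Matrix.fromBlocks_transpose, Matrix.transpose_transpose,
    Matrix.fromBlocks_multiply, Matrix.fromBlocks_multiply]
  simp [hT, hWV]

/-- **The element `diag(ᵗV, W)` of `Sp₄(ℝ)`, `W = V⁻¹`**, image of the integral symplectic matrix `diag(V, ᵗW)` under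
the tree's `toGD 1` (row A4-16). [cite: Lange2023AbelianVarietiesComplex, §8.2 (8.5)] -/
def blockDiagSp (V W : Matrix (Fin 2) (Fin 2) ℤ) (hWV : W * V = 1) : Matrix.symplecticGroup (Fin 2) ℝ :=
  ⟨toGD (fun _ : Fin 2 ↦ 1) (blockDiag V W), toGD_mem principalType_pos (transpose_blockDiag_mul_typeForm_mul hWV)⟩

/-- `diag(1, Δ) = 1` for the principal type. [folklore] -/
private theorem typeDiag_one : typeDiag (fun _ : Fin 2 ↦ 1) = 1 := by
  rw [typeDiag, ← Matrix.fromBlocks_one]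
  simp

/-- `diag(1, Δ)⁻¹ = 1` for the principal type. [folklore] -/
private theorem typeDiagInv_one : typeDiagInv (fun _ : Fin 2 ↦ 1) = 1 := by
  rw [typeDiagInv, ← Matrix.fromBlocks_one]
  simp

/-- **For the principal type `toGD 1 M = ᵗM`.** [cite: Lange2023AbelianVarietiesComplex, §3.1.2 (3.2) and §8.2 (8.5)] -/
theorem toGD_one_eq_transpose (M : Matrix (Fin 2 ⊕ Fin 2) (Fin 2 ⊕ Fin 2) ℤ) :
    toGD (fun _ : Fin 2 ↦ 1) M = (M.map (Int.cast : ℤ → ℝ))ᵀ := by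
  rw [toGD_def, typeDiag_one, typeDiagInv_one, Matrix.one_mul, Matrix.mul_one]

/-- The matrix of `blockDiagSp V W` is `diag(ᵗV, W)`. [cite: Lange2023AbelianVarietiesComplex, §8.2 (8.5)] -/
theorem coe_blockDiagSp {V W : Matrix (Fin 2) (Fin 2) ℤ} (hWV : W * V = 1) :
    ((blockDiagSp V W hWV : Matrix.symplecticGroup (Fin 2) ℝ) : Matrix (Fin 2 ⊕ Fin 2) (Fin 2 ⊕ Fin 2) ℝ) =
      Matrix.fromBlocks (V.map (Int.cast : ℤ → ℝ))ᵀ 0 0 (W.map (Int.cast : ℤ → ℝ)) := by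
  show toGD (fun _ : Fin 2 ↦ 1) (blockDiag V W) = _
  rw [toGD_one_eq_transpose, blockDiag, Matrix.fromBlocks_map, Matrix.fromBlocks_transpose]
  have hW : (Wᵀ.map (Int.cast : ℤ → ℝ))ᵀ = W.map (Int.cast : ℤ → ℝ) := by
    ext i j; simp
  rw [hW]
  simp

/-- **`diag(ᵗV, V⁻¹)` acts on `𝔥₂` by the unimodular congruence `Z ↦ ᵗV Z V`** (`(ᵗV Z + 0)(0·Z + V⁻¹)⁻¹ = ᵗV Z V`).
[cite: Lange2023AbelianVarietiesComplex, §3.1.3 Prop. 3.1.6 and §8.2 (8.5)] -/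
theorem coe_blockDiagSp_smul {V W : Matrix (Fin 2) (Fin 2) ℤ} (hWV : W * V = 1) (Z : siegelUpperHalfSpace 2) :
    ((blockDiagSp V W hWV • Z : siegelUpperHalfSpace 2) : Matrix (Fin 2) (Fin 2) ℂ) =
      (V.map (Int.cast : ℤ → ℂ))ᵀ * (Z : Matrix (Fin 2) (Fin 2) ℂ) * V.map (Int.cast : ℤ → ℂ) := by
  have hWVc : W.map (Int.cast : ℤ → ℂ) * V.map (Int.cast : ℤ → ℂ) = 1 := by
    ext i j
    have h := congrFun (congrFun hWV i) j
    fin_cases i <;> fin_cases j <;>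
      simp [Matrix.mul_apply, Fin.sum_univ_two] at h ⊢ <;> exact_mod_cast h
  have hinv : (W.map (Int.cast : ℤ → ℂ))⁻¹ = V.map (Int.cast : ℤ → ℂ) := Matrix.inv_eq_right_inv hWVc
  have e1 : ((V.map (Int.cast : ℤ → ℝ))ᵀ).map ((↑) : ℝ → ℂ) = (V.map (Int.cast : ℤ → ℂ))ᵀ := by
    ext i j; simp
  have e2 : (W.map (Int.cast : ℤ → ℝ)).map ((↑) : ℝ → ℂ) = W.map (Int.cast : ℤ → ℂ) := by
    ext i j; simp
  have e0 : (0 : Matrix (Fin 2) (Fin 2) ℝ).map ((↑) : ℝ → ℂ) = 0 := by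
    ext i j; simp
  rw [Literature.NumberTheory.ModularForms.SiegelUpperHalfSpace.coe_smul, coe_blockDiagSp, Matrix.fromBlocks_map, e1, e2, e0, moeb_def, num_fromBlocks, denom_fromBlocks,
    add_zero, Matrix.zero_mul, zero_add, hinv]

end BlockDiag

/-! ## §2 The Galois involution and the change of generator are induced by `Sp₄(ℤ)` -/

section Modular

variable {k l : ℤ}

/-- `V = (1 l; 0 −1)` is an involution: `V² = 1`. [folklore] -/
private theorem swapMatrix_mul_self (l : ℤ) : !![(1 : ℤ), l; 0, -1] * !![(1 : ℤ), l; 0, -1] = 1 := by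
  ext i j; fin_cases i <;> fin_cases j <;> simp [Matrix.mul_apply, Fin.sum_univ_two]

/-- `(1 −u; 0 1)(1 u; 0 1) = 1`. [folklore] -/
private theorem shiftMatrix_neg_mul (u : ℤ) : !![(1 : ℤ), -u; 0, 1] * !![(1 : ℤ), u; 0, 1] = 1 := by
  ext i j; fin_cases i <;> fin_cases j <;> simp [Matrix.mul_apply, Fin.sum_univ_two]

/-- **The `Sp₄(ℤ)`-element of the Galois involution**: `P_σ = diag(ᵗV, V)`, `V = (1 l; 0 −1) = V⁻¹`.
[cite: ElkiesKumar2014HilbertModularSurfaces, §3] [cite: Runge1999EndomorphismRingsAbelianSurfaces, §4 p. 291] -/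
def swapSp (l : ℤ) : Matrix.symplecticGroup (Fin 2) ℝ :=
  blockDiagSp !![(1 : ℤ), l; 0, -1] !![(1 : ℤ), l; 0, -1] (swapMatrix_mul_self l)

/-- **The `Sp₄(ℤ)`-element of the change of generator `ω ↦ ω + u`**: `P_u = diag(ᵗU, U⁻¹)`, `U = (1 u; 0 1)`.
[cite: Runge1999EndomorphismRingsAbelianSurfaces, §4 p. 290] -/
def shiftSp (u : ℤ) : Matrix.symplecticGroup (Fin 2) ℝ :=
  blockDiagSp !![(1 : ℤ), u; 0, 1] !![(1 : ℤ), -u; 0, 1] (shiftMatrix_neg_mul u)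

/-- **THE GALOIS INVOLUTION IS INDUCED BY `Sp₄(ℤ)`: `π(τ₂, τ₁) = P_σ · π(τ₁, τ₂)`** with the INTEGRAL symplectic
`P_σ = diag(ᵗV, V)`, `V = (1 l; 0 −1)` — so `π(τ)` and `π(τ^σ)` define the same point of `𝒜₂ = Sp₄(ℤ)\𝔥₂` and the map
`ℍ × ℍ → H_Δ ⊂ 𝒜₂` factors through the involution ("the map from the Hilbert modular surface to the Humbert surface
is generically 2 to 1"). [cite: ElkiesKumar2014HilbertModularSurfaces, §3] [cite: Runge1999EndomorphismRingsAbelianSurfaces, §4 p. 291] -/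
theorem modularEmbedding_swap_eq_smul (hΔ : 0 < quadDisc k l) (τ : Fin 2 → ℍ) :
    modularEmbedding k l hΔ (τ ∘ ⇑(Equiv.swap (0 : Fin 2) 1)) = swapSp l • modularEmbedding k l hΔ τ := by
  apply Subtype.ext
  rw [swapSp, coe_blockDiagSp_smul, coe_modularEmbedding, coe_modularEmbedding]
  have hV : (!![(1 : ℤ), l; 0, -1]).map (Int.cast : ℤ → ℂ) = !![(1 : ℂ), l; 0, -1] := by
    ext i j; fin_cases i <;> fin_cases j <;> simp
  rw [hV, ← modularEmbeddingMatrix_swap]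
  rfl

/-- **THE CHANGE OF GENERATOR IS INDUCED BY `Sp₄(ℤ)`: `π_{(k − lu − u², l + 2u)}(τ) = P_u · π_{(k,l)}(τ)`** with the
INTEGRAL symplectic `P_u = diag(ᵗU, U⁻¹)`, `U = (1 u; 0 1)` (Runge models built on the generators `ω` and `ω + u` of the
SAME order `O` give the same points of `𝒜₂`). [cite: Runge1999EndomorphismRingsAbelianSurfaces, §4 p. 290] -/
theorem modularEmbedding_shift_eq_smul (hΔ : 0 < quadDisc k l) (u : ℤ)
    (hΔ' : 0 < quadDisc (k - l * u - u ^ 2) (l + 2 * u)) (τ : Fin 2 → ℍ) :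
    modularEmbedding (k - l * u - u ^ 2) (l + 2 * u) hΔ' τ = shiftSp u • modularEmbedding k l hΔ τ := by
  apply Subtype.ext
  rw [shiftSp, coe_blockDiagSp_smul, coe_modularEmbedding, coe_modularEmbedding]
  have hU : (!![(1 : ℤ), u; 0, 1]).map (Int.cast : ℤ → ℂ) = !![(1 : ℂ), u; 0, 1] := by
    ext i j; fin_cases i <;> fin_cases j <;> simp
  rw [hU, ← modularEmbeddingMatrix_shift]

/-- **The fixed points of the involution on the model are the diagonal `τ₁ = τ₂`**: `P_σ · π(τ) = π(τ) ⟺ τ₁ = τ₂`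
(`π` is injective, FILE 1) — off the diagonal `τ ↦ π(τ) ∈ Sp₄(ℤ)\𝔥₂` identifies exactly `τ` and `τ^σ`
("generically 2 to 1"; the diagonal maps to the products `E × E`, cf. row A4-63).
[cite: ElkiesKumar2014HilbertModularSurfaces, §3] -/
theorem swapSp_smul_modularEmbedding_eq_self_iff (hΔ : 0 < quadDisc k l) (τ : Fin 2 → ℍ) :
    swapSp l • modularEmbedding k l hΔ τ = modularEmbedding k l hΔ τ ↔ τ 0 = τ 1 := by
  rw [← modularEmbedding_swap_eq_smul hΔ, (modularEmbedding_injective hΔ).eq_iff]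
  constructor
  · intro h
    have h0 := congrFun h 0
    simpa using h0.symm
  · intro h
    funext i
    fin_cases i <;> simp [h]

/-- **On the Humbert loci: `H_{(k−lu−u², l+2u, −1, 0, 0)} = P_u · H_{(k, l, −1, 0, 0)}`** (images of the two Runge
models, FILE 1 `range_modularEmbedding`). [cite: Runge1999EndomorphismRingsAbelianSurfaces, §4 pp. 290–291] -/
theorem humbertLocus_humbertNormalForm_shift (hΔ : 0 < quadDisc k l) (u : ℤ) :
    humbertLocus (fun i ↦ (humbertNormalForm (k - l * u - u ^ 2) (l + 2 * u) i : ℂ)) =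
      (fun Z ↦ shiftSp u • Z) '' humbertLocus (fun i ↦ (humbertNormalForm k l i : ℂ)) := by
  have hΔ' : 0 < quadDisc (k - l * u - u ^ 2) (l + 2 * u) := by rwa [quadDisc_shift]
  rw [← range_modularEmbedding hΔ, ← range_modularEmbedding hΔ', ← Set.range_comp]
  congr 1
  funext τ
  exact modularEmbedding_shift_eq_smul hΔ u hΔ' τ

/-- **The Galois involution preserves the Humbert locus: `P_σ · H_q = H_q`** for the normal form `q = (k, l, −1, 0, 0)`.
[cite: ElkiesKumar2014HilbertModularSurfaces, §3] -/
theorem smul_humbertLocus_humbertNormalForm_swap (hΔ : 0 < quadDisc k l) :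
    (fun Z ↦ swapSp l • Z) '' humbertLocus (fun i ↦ (humbertNormalForm k l i : ℂ)) =
      humbertLocus (fun i ↦ (humbertNormalForm k l i : ℂ)) := by
  rw [← range_modularEmbedding hΔ, ← Set.range_comp]
  apply Set.Subset.antisymm
  · rintro _ ⟨τ, rfl⟩
    exact ⟨τ ∘ ⇑(Equiv.swap (0 : Fin 2) 1), (modularEmbedding_swap_eq_smul hΔ τ)⟩
  · rintro _ ⟨τ, rfl⟩
    refine ⟨τ ∘ ⇑(Equiv.swap (0 : Fin 2) 1), ?_⟩
    show swapSp l • modularEmbedding k l hΔ (τ ∘ ⇑(Equiv.swap (0 : Fin 2) 1)) = modularEmbedding k l hΔ τ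
    have h := (modularEmbedding_swap_eq_smul hΔ (τ ∘ ⇑(Equiv.swap (0 : Fin 2) 1))).symm
    have hτ : (τ ∘ ⇑(Equiv.swap (0 : Fin 2) 1)) ∘ ⇑(Equiv.swap (0 : Fin 2) 1) = τ := by
      funext i; simp [Equiv.swap_apply_self]
    rw [hτ] at h
    exact h

/-- Two normal forms of the same discriminant differ by a change of generator: `l' = l + 2u`, `k' = k − lu − u²`.
[cite: Runge1999EndomorphismRingsAbelianSurfaces, §4 p. 290] -/
theorem exists_shift_of_quadDisc_eq {k l k' l' : ℤ} (h : quadDisc k' l' = quadDisc k l) :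
    ∃ u : ℤ, l' = l + 2 * u ∧ k' = k - l * u - u ^ 2 := by
  simp only [quadDisc] at h
  have hev : Even (l' - l) := by
    rcases Int.even_or_odd (l' - l) with he | ho
    · exact he
    · exfalso
      have ho' : Odd (l' + l) := by
        have : l' + l = (l' - l) + 2 * l := by ring
        rw [this]; exact ho.add_even (even_two_mul l)
      have hprod : Odd ((l' - l) * (l' + l)) := ho.mul ho'
      have heven : Even ((l' - l) * (l' + l)) := ⟨2 * (k - k'), by linear_combination h⟩
      exact (Int.not_odd_iff_even.2 heven) hprod
  obtain ⟨u, hu⟩ := hev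
  refine ⟨u, by linear_combination hu, ?_⟩
  have h4 : (4 : ℤ) * (k' - (k - l * u - u ^ 2)) = 0 := by
    have hl : l' = l + 2 * u := by linear_combination hu
    subst hl
    linear_combination h
  have := (mul_eq_zero.1 h4).resolve_left (by norm_num)
  linear_combination this

/-- **ALL RUNGE MODELS OF DISCRIMINANT `Δ` ARE `Sp₄(ℤ)`-EQUIVALENT: for `l′² + 4k′ = l² + 4k > 0` there is an INTEGRAL
symplectic `M` (`ᵗM E₁ M = E₁`) with `H_{(k′,l′,−1,0,0)} = ᵗM · H_{(k,l,−1,0,0)}`** — the Humbert surface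
`H_Δ = Sp₄(ℤ)\H_{(k,l,−1,0,0)} ⊂ 𝒜₂` of Runge's standard model depends only on `Δ` (the order `O_Δ`), not on the chosen
generator / normal form. [cite: Runge1999EndomorphismRingsAbelianSurfaces, §4 pp. 290–291] [cite: BirkenhakeWilhelm2003, §4 Prop. 4.5 (p. 1828)] -/
theorem exists_humbertLocus_eq_smul_of_quadDisc_eq {k l k' l' : ℤ} (h : quadDisc k' l' = quadDisc k l)
    (hΔ : 0 < quadDisc k l) :
    ∃ (M : Matrix (Fin 2 ⊕ Fin 2) (Fin 2 ⊕ Fin 2) ℤ)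
      (hM : Mᵀ * typeForm (fun _ : Fin 2 ↦ 1) * M = typeForm (fun _ : Fin 2 ↦ 1)),
      humbertLocus (fun i ↦ (humbertNormalForm k' l' i : ℂ)) =
        (fun Z ↦ (⟨toGD (fun _ : Fin 2 ↦ 1) M, toGD_mem principalType_pos hM⟩ : Matrix.symplecticGroup (Fin 2) ℝ) • Z) ''
          humbertLocus (fun i ↦ (humbertNormalForm k l i : ℂ)) := by
  obtain ⟨u, rfl, rfl⟩ := exists_shift_of_quadDisc_eq h
  exact ⟨blockDiag !![(1 : ℤ), u; 0, 1] !![(1 : ℤ), -u; 0, 1],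
    transpose_blockDiag_mul_typeForm_mul (shiftMatrix_neg_mul u), humbertLocus_humbertNormalForm_shift hΔ u⟩

end Modular

end SiegelModuli

end Literature.AlgebraicGeometry.ModuliOfAbelianVarieties
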